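import Literature.MathematicalPhysics.QuantumFieldTheory.BalabanImbrieJaffe1984to88.BIJ88Decay241RegularTorusCwt

/-!
# `BalabanImbrieJaffe1984to88.BIJ88Decay241SmallPlaquetteTorus` — T. Bałaban, J. Imbrie, A. Jaffe, *Effective action and cluster properties of
the abelian Higgs model*, Commun. Math. Phys. **114** (1988) 257–315 [BalabanImbrieJaffe1988], §2 (2.38)–(2.41) p. 264 [PDF 8] and (4.9)
p. 275 [PDF 19]: **THE TORUS-FORM MEMBERS — (2.38)-shape, (2.40)/(4.9)_{j≥1} AND (2.41) FOR `Δ_k(T_η, u)` AT A GENERAL SMALL-PLAQUETTE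
BACKGROUND `u`, EVERY `Λ ⊆ T^{(k)}`, CONSTANTS CHOSEN BEFORE THE INSTANCE — and at a (2.23)-regular `u = e^{ieεA}`.**  The upgrade of this
seat's gen 19/20 located members `BIJ88Decay241SmallFieldTorus.decay241_deltaRegion_smallField` / `Z49_deltaRegion_smallField` — which are
stated at the [I] (4.5.4) backgrounds `u = Q^{s*}_kv·e^{iθ}` only, because their (2.38)-shape input was p33's `ineq732_background_phys` — to ANY
`U(1)` field `u` with `‖u(∂p) − 1‖ ≤ θ`, `(L^{2k}θ)² ≤ θ₀(d, L, a, κ̂)`, using gen 20's (7.3.2) at a general small-plaquette background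
(`BIJ85Ineq732SmallFieldRegion.ineq238_deltaRegion_smallField_region`, here at `Ω = T_η`) as the (2.38)-shape input instead; the (2.36) input is
gen 19's `BIJ88DeltaRegionSmallField236.decay236_torus_smallField_level` (p27's (1.10) engine at small plaquettes), the engines gen 19's abstract
`decay241_smallField` / `Z49_smallField_eq`; the regular-`A` corollaries use gen 21's plaquette size `2c·e_k^β/L^{2k}`
(`BIJ88Decay241RegularTorusCwt.norm_plaqC_expGauge_sub_one_le_of_regular`) and sup-bound lemmas.

statement-level skeleton of published theorems with citation tags; proofs where landed; nothing here is a claim about the Yang–Mills mass gap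

PDF held: `paper:balaban1988-cmp114-bij-abelian-higgs-effective-action` (journal page = PDF page + 256; p. 264 = PDF 8, p. 275 = PDF 19);
`paper:balaban1985-cmp97-bij-higgs-minimizers` (journal page = PDF page + 298; p. 326 = PDF 28: *«let us assume that for the unit lattice field v,
|v(∂p) − 1| ≦ e_kμ(e_k), (7.3.1) … (φ, Δ_k(u_k)φ) ≧ γ Σ|u_k(b)φ(b₊) − φ(b₋)|² − Me_k^{2−α} Σ|φ(x)|² (7.3.2)»*, re-read this session).

CITATION HEADER (lean-in-tree rule).  lit-balaban cell (HOME `run/shared/lean/pub/lit-balaban/`), Phase 2, proof seat **p31 gen 21** (unit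
`lit-balaban-p31`, literature-prover-lit-balaban-p31-g21-0), free-target protocol G.5-34(d), TAKING #2 line HOME/STATUS.md 2026-08-23T02:38:19Z
(stem check `…241SmallPlaquette…` = ∅; notices to r18 / p27 / r15).  Rows of `HOME/lit-balaban-r18/ROWS-C2.md` served (LOCATED MEMBERS, cells only;
heads unchanged; owner r18): **C2.Eq2.38**, **C2.Eq2.40**, **C2.Eq2.41** (+ the (4.9)_{j≥1} token of C3) — torus form `Δ_k(T_η,u)` («region
form, `Ω = T`, no (2.35) localization», gen 19's HONEST SCOPE (ii)); **C1.Eq7.3.1-7.3.2** token (owner r15): (7.3.2) at `u = e^{ieεA}`, `A`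
regular, with the explicit field-strength term `(16/3)d′⁴c²e_k^{2β}`.  Files USED BY NAME, nothing restated: this seat's
`BIJ85Ineq732SmallFieldRegion` (p344913), `BIJ88Decay241SmallFieldTorus` (`decay241_smallField`, `Z49_smallField_eq`, `deltaRegion_conjTranspose`;
p343427/p344337), `BIJ88DeltaRegionSmallField236.decay236_torus_smallField_level` (p342328), `BIJ88Decay241FlatTorus.one_le_ratio`/`c240_smul`
(p341489), `BIJ88Decay241RegularTorusCwt` §1/§7 (p349307), gen 15 `BIJ88DeltaLoc234Torus.deltaRegion`, gen 18 `BIJ88Eq240FlatTorus` (`realify`,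
`compress`, `op240`, `c240`), p03 `BIJ88Normalization46.Z49`/`Z49_pos`, r01 `BIJ85CovariantHiggsDictionary.expGauge`, r15/p11
`BIJ85AbelianStokes.plaqC`, `BIJ85Ineq732FlatRegion.starB_innerK_univ`, pv07 `B4Sect5Torus.weightC`/`B4Sect5Proof.latticeConst`, p38 `B5Ineq137Torus.T`.

## The print (verbatim, p. 264 [PDF 8])

*"Finally, in view of (2.35), the lower bound (I.7.3.2) applies to Δ_{k,loc}(u) as well. Let φ be supported in a region having an r(e_k)
neighborhood where u is smooth. Then ⟨φ, Δ_{k,loc}(u)φ⟩ ≧ c₁ Σ_b |u(b)φ(b₊) − φ(b₋)|² − c e_k² p(e_k)² Σ_x |φ(x)|². (2.38) Finally, we need to construct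
a localized version of C^{(k)}_Λ(Ω, u) = [(Δ_k(Ω, u) + aL^{−2} Q(u_k)^* Q(u_k))|_Λ]^{−1}, (2.39) the single-scale propagator for the scalar field in the
k-th step. We have already replaced Δ_k(Ω, u) with Δ_{k,loc}(u). Let us assume u is smooth in a neighborhood of Λ̄, the region for the Dirichlet
boundary conditions in (2.39). We define C^{(k)}_Λ(u) = [(Δ_{k,loc}(u) + aL^{−2} Q(u_k)^* Q(u_k))|_Λ]^{−1}. (2.40) This is of course a nonlocal operator,
but by (2.38), C^{(k)}_Λ(u)^{−1} is bounded below and a random walk expansion as in [6] can be used to prove that |C^{(k)}_Λ(u; x₁, x₂)| ≦ c e^{−c|x₁−x₂|}.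
(2.41)"*
(v1.2 DOC-ONLY, gen 22: this block is now the verbatim print — PDF p0008 L2–15, referee asks ref-1 g78/g79 and ref-5 D-g65-3: the printed
(2.38) carries the support condition on φ; (2.39) is the region propagator C^{(k)}_Λ(Ω,u), (2.40) the localized C^{(k)}_Λ(u); the earlier text
«An important consequence of (2.35) …» / «… bounded below (2.40)» was a paraphrase with the labels (2.39)/(2.40) swapped. No declaration changed.) — here for the REGION FORM `Δ_k(Ω,u)` of
(2.34)/[I] (4.6.4) with `Ω = T_η` in place of `Δ_{k,loc}(u)` (the two differ by the (2.35) error; the `Δ_{k,loc}` members are this seat's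
`BIJ88DeltaLocClose235General` §5–§8 / `BIJ88Decay241RegularTorusCwt`).

## What is proved (0 `sorry`; theorems only — no definition, no `Prop`-valued fact)

* §1 **`ineq238_torus_smallPlaquette`** — the (2.38)-shape = [I] (7.3.2) for `Δ_k(T_η,u)` at ANY `U(1)` field with `‖u(∂p) − 1‖ ≤ θ`, EVERY `φ`:
  `(A/a_k)·[γ₀Σ_b‖u_k(b)φ(b₊) − φ(b₋)‖² − (4/3)d′⁴(L^{2k}θ)²·Σ_y‖φ(y)‖²] ≤ Re⟨φ, Δ_k(T_η,u)φ⟩`, `γ₀ = min(a/(9(d′+1)), 1/12)` (gen 20's region theorem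
  at `Ω = T`); **`ineq238_regular_torus`** — the same at `u = e^{ieεA}`, `A` (2.23)-regular on the torus, error term `(4/3)d′⁴(2c·e_k^β)²`.
* §2 **`Z49_torus_smallPlaquette`** — (2.40) and (4.9)_{j≥1}: for `(d, L, a, κ̂)` (`d ≥ 1`, `L ≥ 2`) there is `θ₀ > 0` such that on every torus,
  every `1 ≤ k ≤ K` with a next lattice, every `u` with `‖u(∂p) − 1‖ ≤ θ`, `(L^{2k}θ)² ≤ θ₀`, averaged field `u_k` with `‖u_k(b) − 1‖ ≤ T₁` inside
  the `L`-blocks, `‖u_k(Γ_{yx}) − 1‖ ≤ δ′`, `2(L−1)L·d·T₁² + 2δ′² ≤ ½`, EVERY `Λ` and every `(E_s, N)`: `realify((Δ_k(T,u) + (A/a_k)κ̂P(u_k))|_Λ)` is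
  positive definite, `Z^{(k)}_Λ = e^{−E_sN}√(2π)^{2|Λ|}/√det`, `Z^{(k)}_Λ > 0`; **`Z49_regular_torus`** — the same at regular `A` with
  `(2c·e_k^β)² ≤ θ₀`.
* §3 **`decay241_torus_smallPlaquette`** — (2.41): for `(d, L, a, κ̂)` with `1 ≤ d ≤ 3`, `L` odd `> 1` (p27's (1.10) scope) there are
  `θ₀, δ₁, c₂ > 0` such that, under the same hypotheses, `‖C^{(k)}(T,u)|_Λ(x₁,x₂)‖ ≤ (a_k/A)·c₂·e^{−δ₁|x₁−x₂|_{T^{(k)}}}` for all `x₁, x₂ ∈ Λ`,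
  uniformly in `ε`, the torus, `k`, `Λ`, `u`; `decay241_torus_smallPlaquette_printed` (the factor `a_k/A ≤ 1` dropped);
  **`decay241_regular_torus`** (at regular `A`, `(2c·e_k^β)² ≤ θ₀`) and **`decay241_regular_torus_of_sup`** (the averaged-field smallness from
  `‖A‖_∞ ≤ A_∞`: `T₁ = L^kε|e|A_∞`, `δ′ = d(L−1)T₁`, gen 21 §7).
* §4 **`decay241_torus_smallPlaquette_gaugeAct`** / **`decay241_regular_torus_gaugeAct`** — (2.41) at EVERY gauge transform `u^h` (resp.
  `(e^{ieεA})^h`): [I] p. 326 *«by change of gauge u_k can be transformed … into a configuration of the form exp[ie_kηA], where A is smooth and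
  small»* — hypotheses on the representative, conclusion for `u^h` (gen 19's `op240_deltaRegion_gaugeAct` + (2.8) `lineIter_gaugeAct`).
* §5 (v1.1) **`op240_deltaLocT_gaugeAct`** (the (2.39)/(2.40) operator on the LOCALIZED form `Δ_{k,loc}` is gauge covariant — gen 15's
  `deltaLocT_gaugeAct`) and **`decay241_regular_torus_cwt_gaugeAct`** — gen 21's `BIJ88Decay241RegularTorusCwt.decay241_regular_torus_cwt`
  ((2.41) for `Δ_{k,loc}(e^{ieεA})`, printed data with big-block cubes) at EVERY gauge transform `(e^{ieεA})^h`.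

HONEST SCOPE / DIVERGENCE.  (i) REGION FORM `Δ_k(T_η,u)` (no localization), as gen 19's HONEST (ii); the `Δ_{k,loc}` members at regular `A` are
`BIJ88DeltaLocClose235General`/`BIJ88Decay241RegularTorusCwt`, at bondwise-small `u` they wait for a non-flat (H1.12).  (ii) Hypotheses on `u`:
the plaquette size `θ` (print's (7.3.1) / *"ce_k²p(e_k)²"* read as `(4/3)d′⁴(L^{2k}θ)²`, gen 20's HONEST (v)) and the averaged-field smallness
`(T₁, δ′)` of `u_k` ([I] (4.5.4) shape; at regular `A` supplied by a sup bound on `A`, §3) — NO gauge condition, no `bg454` form.  (iii) Constants: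
`θ₀, δ₁, c₂` depend on `(d, L, a, κ̂)` only (explicit in the proof: `γ₀`, `c_S = c240(γ₀,κ̂)`, p27's `(δ₀, c₀)`); `σ = ½` fixed.  (iv) §3 needs
`d ≤ 3`, `L` odd (p27's engine); §1–§2 any `d ≥ 1`, `L ≥ 2`.  (v) `1 ≤ k ≤ K`, `k + 1 ≤ m + K`; fine level `0`.  Imports: gen 21's
`BIJ88Decay241RegularTorusCwt` only (→ r18, `BIJ88DeltaLocClose235General`, `BIJ88Decay241SmallFieldTorus`, …).  Literature + Mathlib only.  Unit
`lit-balaban-p31` (literature-prover-lit-balaban-p31-g21-0), 2026-08-23.  v1.1 = v1 (p351239) + §5 appended and this docstring's §5 lines; every v1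
declaration byte-identical.  NOT summit progress.
-/

open scoped BigOperators Matrix ComplexConjugate
open Finset Matrix

namespace Literature.MathematicalPhysics.QuantumFieldTheory.BalabanImbrieJaffe1984to88.BIJ88Decay241SmallPlaquetteTorus

open Literature.MathematicalPhysics.QuantumFieldTheory.Balaban1983to89
open BIJ88Sect3Statements (U1 toC)
open BIJ85BlockAveragesTorus BIJ85BlockAveragesTorusK
open BIJ88DeltaLoc234Torus (deltaRegion)
open BIJ85CovariantHiggsDictionary (expGauge)
open BIJ85AbelianStokes (plaqC)
open BIJ88NeumannNoZeroModesTorus (isBlockUnion_univ)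
open BIJ85Ineq732FlatRegion (starB_innerK_univ)
open BIJ85Ineq732SmallFieldRegion (innerK_univ ineq238_deltaRegion_smallField_region)
open BIJ88Eq240FlatTorus (realify compress op240 c240)
open BIJ88Normalization46 (Z49 Z49_pos)
open BIJ88Decay241FlatTorus (c240_smul one_le_ratio)
open BIJ88Decay241SmallFieldTorus (decay241_smallField Z49_smallField_eq deltaRegion_conjTranspose op240_deltaRegion_gaugeAct)
open BIJ88DeltaLoc234Torus (mulOpK)
open GaugeField (gaugeAct)
open BIJ88DeltaRegionSmallField236 (decay236_torus_smallField_level)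
open BIJ88Decay241RegularTorusCwt (norm_plaqC_expGauge_sub_one_le_of_regular norm_toC_lineIter_expGauge_sub_one_le
  norm_holCK_one_sub_one_le)
open B4Sect5Torus (weightC)

noncomputable section

/-! ## §1 The (2.38)-shape = [I] (7.3.2) for `Δ_k(T_η,u)` at a general small-plaquette `u`, and at a regular `A` -/

section Shape238

variable {P : Params}

/-- **[I] (7.3.2) / THE (2.38)-SHAPE FOR THE TORUS FORM `Δ_k(T_η,u)` AT A GENERAL SMALL-PLAQUETTE BACKGROUND, EVERY `φ`** (p. 264 (2.38) with
`Δ_k(Ω,u)`, `Ω = T_η`; [I] p. 326 (7.3.2)): for every `U(1)` field `u` with `‖u(∂p) − 1‖ ≤ θ` and every `φ` on `T^{(k)}`,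
`(A/a_k)·[γ₀Σ_b‖u_k(b)φ(b₊) − φ(b₋)‖² − (4/3)d′⁴(L^{2k}θ)²·Σ_y‖φ(y)‖²] ≤ Re⟨φ, Δ_k(T_η,u)φ⟩`, `γ₀ = min(a/(9(d′+1)), 1/12)`, `A = α_kL^{kd′}`,
`u_k = lineIter u k` — gen 20's `ineq238_deltaRegion_smallField_region` at `Ω = T` (all bonds, all sites). [cite: BalabanImbrieJaffe1985, (7.3.2) p.326]
[cite: BalabanImbrieJaffe1988, (2.38) p.264] -/
theorem ineq238_torus_smallPlaquette {k : ℕ} (hk1 : 1 ≤ k) (hk : 0 + k ≤ P.m + P.K) {a : ℝ} (ha : 0 < a) (U : GaugeField P 0 U1)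
    {θ : ℝ} (hθ : ∀ (x : Balaban1983to89.Site P 0) (μ ν : Fin P.d), ‖plaqC U x μ ν - 1‖ ≤ θ)
    (φ : Balaban1983to89.Site P (0 + k) → ℂ) :
    (B1RG242Torus.α P a k * (P.L : ℝ) ^ (k * P.d)) / B1.aSeq a P.L k *
        (min (a / (9 * (P.d + 1))) (1 / 12) * ∑ b : PBond P (0 + k), ‖toC (lineIter U k b) * φ b.tgt - φ b.src‖ ^ 2
          - 4 / 3 * (P.d : ℝ) ^ 4 * (((P.L : ℝ) ^ k) ^ 2 * θ) ^ 2 * ∑ y : Balaban1983to89.Site P (0 + k), ‖φ y‖ ^ 2)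
      ≤ (star φ ⬝ᵥ (deltaRegion (B1RG242Torus.α P a k * (P.L : ℝ) ^ (k * P.d)) P.eps⁻¹ U k univ *ᵥ φ)).re := by
  have h := ineq238_deltaRegion_smallField_region hk1 hk ha U hθ (isBlockUnion_univ k) φ
  rwa [starB_innerK_univ, innerK_univ] at h

/-- **[I] (7.3.2) / THE (2.38)-SHAPE FOR `Δ_k(T_η, e^{ieεA})` AT A (2.23)-REGULAR `A` ON THE TORUS, EVERY `φ`** ([I] p. 326: *«−Me_k^{2−α}Σ|φ(x)|²»*
for *«exp[ie_kηA], where A is smooth»*): if `L^kε|e|/e_k·|A(⟨z+e_μ,ν⟩) − A(⟨z,ν⟩)| ≦ c·e_k^{β−1}/L^k` everywhere (`0 < e_k`), then for every `φ`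
`(A/a_k)·[γ₀Σ_b‖u_k(b)φ(b₊) − φ(b₋)‖² − (4/3)d′⁴(2c·e_k^β)²·Σ_y‖φ(y)‖²] ≤ Re⟨φ, Δ_k(T_η,u)φ⟩`, `u = e^{ieεA}` — §1's theorem with gen 21's plaquette
size `2c·e_k^β/L^{2k}`. [cite: BalabanImbrieJaffe1985, (7.3.2) p.326] [cite: BalabanImbrieJaffe1988, (2.38) p.264] -/
theorem ineq238_regular_torus {k : ℕ} (hk1 : 1 ≤ k) (hk : 0 + k ≤ P.m + P.K) {a : ℝ} (ha : 0 < a) {e creg β ec : ℝ} (hec : 0 < ec)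
    {A : PBond P 0 → ℝ}
    (hreg : ∀ (z : Balaban1983to89.Site P 0) (μ ν : Fin P.d),
      P.spacing k * |e| / ec * |A ⟨z.shift μ, ν⟩ - A ⟨z, ν⟩| ≤ creg * ec ^ (β - 1) / (P.L : ℝ) ^ k)
    (φ : Balaban1983to89.Site P (0 + k) → ℂ) :
    (B1RG242Torus.α P a k * (P.L : ℝ) ^ (k * P.d)) / B1.aSeq a P.L k *
        (min (a / (9 * (P.d + 1))) (1 / 12) *
            ∑ b : PBond P (0 + k), ‖toC (lineIter (expGauge P e A) k b) * φ b.tgt - φ b.src‖ ^ 2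
          - 4 / 3 * (P.d : ℝ) ^ 4 * (2 * creg * ec ^ β) ^ 2 * ∑ y : Balaban1983to89.Site P (0 + k), ‖φ y‖ ^ 2)
      ≤ (star φ ⬝ᵥ (deltaRegion (B1RG242Torus.α P a k * (P.L : ℝ) ^ (k * P.d)) P.eps⁻¹ (expGauge P e A) k univ *ᵥ φ)).re := by
  have h := ineq238_torus_smallPlaquette hk1 hk ha (expGauge P e A)
    (fun x μ ν => norm_plaqC_expGauge_sub_one_le_of_regular (k := k) hec hreg x μ ν) φ
  have hLk : (0 : ℝ) < (P.L : ℝ) ^ k := pow_pos P.cast_L_pos k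
  rwa [mul_div_cancel₀ _ (pow_pos hLk 2).ne'] at h

end Shape238

/-! ## §2 (2.40) and (4.9)_{j≥1} for `Δ_k(T_η,u)` at a general small-plaquette `u`, every `Λ`, `θ₀` chosen before the instance -/

section Member240

/-- kernel (the data of §2/§3 packaged): for `(d, L, a, κ̂)` there is `θ₀ > 0` such that at every `u` with `‖u(∂p) − 1‖ ≤ θ`, `(L^{2k}θ)² ≤ θ₀`, §1
supplies `γ ≥ 0`, `E` with `E < c240(γ, (A/a_k)κ̂)·(1 − ½)` and the (2.38)-shape bound for EVERY `φ` (`γ = (A/a_k)γ₀`, `E = (A/a_k)(4/3)d⁴(L^{2k}θ)²`).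
[cite: BalabanImbrieJaffe1988, (2.38) p.264] -/
private theorem smallPlaquette_package238 (d L : ℕ) (hd : 1 ≤ d) (hL2 : 2 ≤ L) {a : ℝ} (ha : 0 < a) {κ' : ℝ} (hκ' : 0 < κ') :
    ∃ θ₀ : ℝ, 0 < θ₀ ∧ ∀ (P : Params), P.d = d → P.L = L →
      ∀ k : ℕ, 1 ≤ k → k ≤ P.K → k + 1 ≤ P.m + P.K →
      ∀ (U : GaugeField P 0 U1) (θ : ℝ), (∀ (y : Balaban1983to89.Site P 0) (μ ν : Fin P.d), ‖plaqC U y μ ν - 1‖ ≤ θ) →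
        (((P.L : ℝ) ^ k) ^ 2 * θ) ^ 2 ≤ θ₀ →
      ∃ γ E : ℝ, 0 ≤ γ ∧ 0 ≤ (B1RG242Torus.α P a k * (P.L : ℝ) ^ (k * P.d)) / B1.aSeq a P.L k * κ' ∧
        E < c240 P γ ((B1RG242Torus.α P a k * (P.L : ℝ) ^ (k * P.d)) / B1.aSeq a P.L k * κ') * (1 - 1 / 2) ∧
        ∀ φ : Balaban1983to89.Site P (0 + k) → ℂ,
          γ * ∑ B : PBond P (0 + k), ‖toC (lineIter U k B) * φ B.tgt - φ B.src‖ ^ 2 - E * ∑ x, ‖φ x‖ ^ 2 ≤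
            (star φ ⬝ᵥ (deltaRegion (B1RG242Torus.α P a k * (P.L : ℝ) ^ (k * P.d)) P.eps⁻¹ U k univ *ᵥ φ)).re := by
  have hdr1 : (1 : ℝ) ≤ d := by exact_mod_cast hd
  have hLr2 : (2 : ℝ) ≤ L := by exact_mod_cast hL2
  obtain ⟨g0, hg0⟩ : ∃ x : ℝ, x = min (a / (9 * ((d : ℝ) + 1))) (1 / 12) := ⟨_, rfl⟩
  obtain ⟨cS, hcS⟩ : ∃ x : ℝ, x = min (g0 / (2 * (((L : ℝ) - 1) * L))) (κ' / (2 * (L : ℝ) ^ d)) := ⟨_, rfl⟩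
  obtain ⟨Z, hZ⟩ : ∃ x : ℝ, x = 4 / 3 * (d : ℝ) ^ 4 := ⟨_, rfl⟩
  obtain ⟨θ₀, hθ₀⟩ : ∃ x : ℝ, x = cS / (4 * (Z + 1)) := ⟨_, rfl⟩
  have hg00 : 0 < g0 := by rw [hg0]; exact lt_min (by positivity) (by norm_num)
  have hLL : (0 : ℝ) < 2 * (((L : ℝ) - 1) * L) := by nlinarith
  have hcS0 : 0 < cS := by rw [hcS]; exact lt_min (div_pos hg00 hLL) (by positivity)
  have hZ0 : 0 ≤ Z := by rw [hZ]; positivity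
  have hθ₀0 : 0 < θ₀ := by rw [hθ₀]; positivity
  refine ⟨θ₀, hθ₀0, ?_⟩
  intro P hPd hPL k hk1 hkK hk' U θ hθ hτ
  have hLr : (P.L : ℝ) = (L : ℝ) := by rw [hPL]
  have hdr : (P.d : ℝ) = (d : ℝ) := by rw [hPd]
  have hk0 : 0 + k ≤ P.m + P.K := by rw [Nat.zero_add]; exact (Nat.le_succ k).trans hk'
  have hak0 : 0 < B1.aSeq a P.L k := B1.aSeq_pos ha (B1RG242Torus.one_lt_cast_L P) hk1
  have hα : 0 < B1RG242Torus.α P a k := mul_pos hak0 (inv_pos.mpr (pow_pos (P.spacing_pos k) 2))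
  have hA0 : 0 < B1RG242Torus.α P a k * (P.L : ℝ) ^ (k * P.d) := mul_pos hα (pow_pos P.cast_L_pos _)
  have h238raw := fun φ => ineq238_torus_smallPlaquette hk1 hk0 ha U hθ φ
  obtain ⟨A, hAdef⟩ : ∃ x : ℝ, x = B1RG242Torus.α P a k * (P.L : ℝ) ^ (k * P.d) := ⟨_, rfl⟩
  obtain ⟨ak, hakdef⟩ : ∃ x : ℝ, x = B1.aSeq a P.L k := ⟨_, rfl⟩
  rw [← hAdef, ← hakdef] at h238raw ⊢
  rw [← hAdef] at hA0
  rw [← hakdef] at hak0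
  obtain ⟨s, hsdef⟩ : ∃ x : ℝ, x = A / ak := ⟨_, rfl⟩
  rw [← hsdef] at h238raw ⊢
  have hs0 : 0 < s := by rw [hsdef]; exact div_pos hA0 hak0
  obtain ⟨τ2, hτ2def⟩ : ∃ x : ℝ, x = (((P.L : ℝ) ^ k) ^ 2 * θ) ^ 2 := ⟨_, rfl⟩
  rw [← hτ2def] at hτ
  obtain ⟨E, hE⟩ : ∃ x : ℝ, x = s * (Z * τ2) := ⟨_, rfl⟩
  have h238 : ∀ φ : Balaban1983to89.Site P (0 + k) → ℂ,
      s * g0 * ∑ B : PBond P (0 + k), ‖toC (lineIter U k B) * φ B.tgt - φ B.src‖ ^ 2 - E * ∑ x, ‖φ x‖ ^ 2 ≤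
        (star φ ⬝ᵥ (deltaRegion A P.eps⁻¹ U k univ *ᵥ φ)).re := by
    intro φ
    have h := h238raw φ
    rw [hdr, ← hg0, ← hτ2def] at h
    have e : s * (g0 * ∑ B : PBond P (0 + k), ‖toC (lineIter U k B) * φ B.tgt - φ B.src‖ ^ 2
          - 4 / 3 * (d : ℝ) ^ 4 * τ2 * ∑ x, ‖φ x‖ ^ 2)
        = s * g0 * ∑ B : PBond P (0 + k), ‖toC (lineIter U k B) * φ B.tgt - φ B.src‖ ^ 2 - E * ∑ x, ‖φ x‖ ^ 2 := by
      rw [hE, hZ]; ring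
    rw [← e]; exact h
  have hc240S : c240 P g0 κ' = cS := by rw [c240, hLr, hPd, hcS]
  have hcv : c240 P (s * g0) (s * κ') = s * cS := by rw [c240_smul P hs0.le, hc240S]
  have hEle : E ≤ s * cS / 4 := by
    have h1 : Z * τ2 ≤ cS / 4 := by
      have h2 : Z * τ2 ≤ Z * (cS / (4 * (Z + 1))) := mul_le_mul_of_nonneg_left (by rw [← hθ₀]; exact hτ) hZ0
      have h3 : Z * (cS / (4 * (Z + 1))) ≤ cS / 4 := by
        rw [mul_div_assoc', div_le_div_iff₀ (by positivity) (by norm_num : (0 : ℝ) < 4)]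
        have e4 : cS * (4 * (Z + 1)) = Z * cS * 4 + 4 * cS := by ring
        rw [e4]
        linarith only [hcS0.le]
      linarith only [h2, h3]
    rw [hE]
    have := mul_le_mul_of_nonneg_left h1 hs0.le
    linarith only [this]
  have hsc : 0 < s * cS / 4 := by positivity
  have hElt : E < c240 P (s * g0) (s * κ') * (1 - 1 / 2) := by rw [hcv]; linarith only [hEle, hsc]
  exact ⟨s * g0, E, mul_nonneg hs0.le hg00.le, mul_nonneg hs0.le hκ'.le, hElt, h238⟩

/-- **(2.40) AND (4.9)_{j≥1} FOR THE TORUS FORM `Δ_k(T_η,u)` AT A GENERAL SMALL-PLAQUETTE BACKGROUND, EVERY `Λ`, `θ₀` CHOSEN BEFORE THE INSTANCE**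
(p. 264: *"We define C^{(k)}_Λ(u) = […]^{−1}. (2.40) … by (2.38), C^{(k)}_Λ(u)^{−1} is bounded below"*; p. 275 (4.9)): for every `(d, L, a, κ̂)` (`d ≥ 1`, `L ≥ 2`, `κ̂ > 0`) there is
`θ₀ > 0` such that for every torus, `1 ≤ k ≤ K` with a next lattice, every `U(1)` field `u` with `‖u(∂p) − 1‖ ≤ θ` and `(L^{2k}θ)² ≤ θ₀`, averaged
field `u_k = lineIter u k` with `‖u_k(b) − 1‖ ≤ T₁` inside the `L`-blocks of `T^{(k)}`, `‖u_k(Γ_{yx}) − 1‖ ≤ δ′`, `2(L−1)L·d·T₁² + 2δ′² ≤ ½`, EVERY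
`Λ ⊆ T^{(k)}` and every `(E_s, N)`: the precision matrix `realify((Δ_k(T,u) + (A/a_k)κ̂P(u_k))|_Λ)` is POSITIVE DEFINITE,
`Z^{(k)}_Λ(u) = e^{−E_sN}·√(2π)^{2|Λ|}/√det` and `Z^{(k)}_Λ(u) > 0` — gen 20's `Z49_deltaRegion_smallField` with the `bg454` background replaced by ANY
small-plaquette `u` (gen 19's `Z49_smallField_eq` on §1). [cite: BalabanImbrieJaffe1988, (2.40) p.264] [cite: BalabanImbrieJaffe1988, (4.9) p.275] -/
theorem Z49_torus_smallPlaquette (d L : ℕ) (hd : 1 ≤ d) (hL2 : 2 ≤ L) {a : ℝ} (ha : 0 < a) {κ' : ℝ} (hκ' : 0 < κ') :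
    ∃ θ₀ : ℝ, 0 < θ₀ ∧ ∀ (P : Params), P.d = d → P.L = L →
      ∀ k : ℕ, 1 ≤ k → k ≤ P.K → k + 1 ≤ P.m + P.K →
      ∀ (U : GaugeField P 0 U1) (θ : ℝ), (∀ (y : Balaban1983to89.Site P 0) (μ ν : Fin P.d), ‖plaqC U y μ ν - 1‖ ≤ θ) →
        (((P.L : ℝ) ^ k) ^ 2 * θ) ^ 2 ≤ θ₀ →
      ∀ T₁ δ' : ℝ, (∀ B : PBond P (0 + k), blkIter 1 B.src = blkIter 1 B.tgt → ‖toC (lineIter U k B) - 1‖ ≤ T₁) →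
        (∀ x : Balaban1983to89.Site P (0 + k), ‖holCK (lineIter U k) 1 x - 1‖ ≤ δ') →
        2 * (((P.L : ℝ) - 1) * P.L) * P.d * T₁ ^ 2 + 2 * δ' ^ 2 ≤ 1 / 2 →
      ∀ (Λ : Finset (Balaban1983to89.Site P (0 + k))) (Es N : ℝ),
        (realify (compress Λ (op240 (deltaRegion (B1RG242Torus.α P a k * (P.L : ℝ) ^ (k * P.d)) P.eps⁻¹ U k univ)
          ((B1RG242Torus.α P a k * (P.L : ℝ) ^ (k * P.d)) / B1.aSeq a P.L k * κ') (lineIter U k)))).PosDef ∧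
        Z49 (realify (compress Λ (op240 (deltaRegion (B1RG242Torus.α P a k * (P.L : ℝ) ^ (k * P.d)) P.eps⁻¹ U k univ)
          ((B1RG242Torus.α P a k * (P.L : ℝ) ^ (k * P.d)) / B1.aSeq a P.L k * κ') (lineIter U k)))) Es N =
          Real.exp (-(Es * N)) * (Real.sqrt (2 * Real.pi) ^ Fintype.card (↥Λ × Fin 2) /
            Real.sqrt (realify (compress Λ (op240 (deltaRegion (B1RG242Torus.α P a k * (P.L : ℝ) ^ (k * P.d)) P.eps⁻¹ U k univ)
              ((B1RG242Torus.α P a k * (P.L : ℝ) ^ (k * P.d)) / B1.aSeq a P.L k * κ') (lineIter U k)))).det) ∧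
        0 < Z49 (realify (compress Λ (op240 (deltaRegion (B1RG242Torus.α P a k * (P.L : ℝ) ^ (k * P.d)) P.eps⁻¹ U k univ)
          ((B1RG242Torus.α P a k * (P.L : ℝ) ^ (k * P.d)) / B1.aSeq a P.L k * κ') (lineIter U k)))) Es N := by
  obtain ⟨θ₀, hθ₀0, hpk⟩ := smallPlaquette_package238 d L hd hL2 ha hκ'
  refine ⟨θ₀, hθ₀0, ?_⟩
  intro P hPd hPL k hk1 hkK hk' U θ hθ hτ T₁ δ' hInt hTree hσ Λ Es N
  obtain ⟨γ, E, hγ, hκ, hE, h238⟩ := hpk P hPd hPL k hk1 hkK hk' U θ hθ hτ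
  have hj : (0 + k) + 1 ≤ P.m + P.K := by rw [Nat.zero_add]; exact hk'
  have hk0 : 0 + k ≤ P.m + P.K := by rw [Nat.zero_add]; exact (Nat.le_succ k).trans hk'
  have hak0 : 0 < B1.aSeq a P.L k := B1.aSeq_pos ha (B1RG242Torus.one_lt_cast_L P) hk1
  have hα : 0 < B1RG242Torus.α P a k := mul_pos hak0 (inv_pos.mpr (pow_pos (P.spacing_pos k) 2))
  have hA0 : 0 < B1RG242Torus.α P a k * (P.L : ℝ) ^ (k * P.d) := mul_pos hα (pow_pos P.cast_L_pos _)
  have hΔ : (deltaRegion (B1RG242Torus.α P a k * (P.L : ℝ) ^ (k * P.d)) P.eps⁻¹ U k univ).IsHermitian :=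
    deltaRegion_conjTranspose hk0 (inv_ne_zero P.eps_pos.ne') hA0 _ (isBlockUnion_univ k)
  have h := Z49_smallField_eq (Λ := Λ) hj (lineIter U k) hInt hTree hσ hΔ hγ hκ hE (fun φ _ => h238 φ) Es N
  exact ⟨h.1, h.2, Z49_pos _ h.1 Es N⟩

/-- **(2.40) AND (4.9)_{j≥1} FOR `Δ_k(T_η, e^{ieεA})` AT A (2.23)-REGULAR `A`, EVERY `Λ`** ([I] p. 326 *«exp[ie_kηA], where A is smooth and small»*):
`Z49_torus_smallPlaquette` with the plaquette condition discharged by regularity — `(2c·e_k^β)² ≤ θ₀` (gen 21's plaquette size `2c·e_k^β/L^{2k}`);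
the averaged-field smallness of `u_k` displayed. [cite: BalabanImbrieJaffe1988, (2.40) p.264] [cite: BalabanImbrieJaffe1988, (4.9) p.275] -/
theorem Z49_regular_torus (d L : ℕ) (hd : 1 ≤ d) (hL2 : 2 ≤ L) {a : ℝ} (ha : 0 < a) {κ' : ℝ} (hκ' : 0 < κ') (e creg β : ℝ) :
    ∃ θ₀ : ℝ, 0 < θ₀ ∧ ∀ (P : Params), P.d = d → P.L = L →
      ∀ k : ℕ, 1 ≤ k → k ≤ P.K → k + 1 ≤ P.m + P.K →
      ∀ (A : PBond P 0 → ℝ) (ec : ℝ), 0 < ec →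
      (∀ (z : Balaban1983to89.Site P 0) (μ ν : Fin P.d),
          P.spacing k * |e| / ec * |A ⟨z.shift μ, ν⟩ - A ⟨z, ν⟩| ≤ creg * ec ^ (β - 1) / (L : ℝ) ^ k) →
      (2 * creg * ec ^ β) ^ 2 ≤ θ₀ →
      ∀ T₁ δ' : ℝ, (∀ B : PBond P (0 + k), blkIter 1 B.src = blkIter 1 B.tgt → ‖toC (lineIter (expGauge P e A) k B) - 1‖ ≤ T₁) →
        (∀ x : Balaban1983to89.Site P (0 + k), ‖holCK (lineIter (expGauge P e A) k) 1 x - 1‖ ≤ δ') →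
        2 * (((P.L : ℝ) - 1) * P.L) * P.d * T₁ ^ 2 + 2 * δ' ^ 2 ≤ 1 / 2 →
      ∀ (Λ : Finset (Balaban1983to89.Site P (0 + k))) (Es N : ℝ),
        (realify (compress Λ (op240 (deltaRegion (B1RG242Torus.α P a k * (P.L : ℝ) ^ (k * P.d)) P.eps⁻¹ (expGauge P e A) k univ)
          ((B1RG242Torus.α P a k * (P.L : ℝ) ^ (k * P.d)) / B1.aSeq a P.L k * κ') (lineIter (expGauge P e A) k)))).PosDef ∧
        Z49 (realify (compress Λ (op240 (deltaRegion (B1RG242Torus.α P a k * (P.L : ℝ) ^ (k * P.d)) P.eps⁻¹ (expGauge P e A) k univ)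
          ((B1RG242Torus.α P a k * (P.L : ℝ) ^ (k * P.d)) / B1.aSeq a P.L k * κ') (lineIter (expGauge P e A) k)))) Es N =
          Real.exp (-(Es * N)) * (Real.sqrt (2 * Real.pi) ^ Fintype.card (↥Λ × Fin 2) /
            Real.sqrt (realify (compress Λ (op240 (deltaRegion (B1RG242Torus.α P a k * (P.L : ℝ) ^ (k * P.d)) P.eps⁻¹ (expGauge P e A) k
              univ) ((B1RG242Torus.α P a k * (P.L : ℝ) ^ (k * P.d)) / B1.aSeq a P.L k * κ') (lineIter (expGauge P e A) k)))).det) ∧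
        0 < Z49 (realify (compress Λ (op240 (deltaRegion (B1RG242Torus.α P a k * (P.L : ℝ) ^ (k * P.d)) P.eps⁻¹ (expGauge P e A) k univ)
          ((B1RG242Torus.α P a k * (P.L : ℝ) ^ (k * P.d)) / B1.aSeq a P.L k * κ') (lineIter (expGauge P e A) k)))) Es N := by
  obtain ⟨θ₀, hθ₀0, H⟩ := Z49_torus_smallPlaquette d L hd hL2 ha hκ'
  refine ⟨θ₀, hθ₀0, ?_⟩
  intro P hPd hPL k hk1 hkK hk' A ec hec hreg hsmall T₁ δ' hInt hTree hσ Λ Es N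
  subst hPL
  have hLk : (0 : ℝ) < (P.L : ℝ) ^ k := pow_pos P.cast_L_pos k
  refine H P hPd rfl k hk1 hkK hk' (expGauge P e A) (2 * creg * ec ^ β / ((P.L : ℝ) ^ k) ^ 2)
    (fun y μ ν => norm_plaqC_expGauge_sub_one_le_of_regular (k := k) hec hreg y μ ν) ?_ T₁ δ' hInt hTree hσ Λ Es N
  rwa [mul_div_cancel₀ _ (pow_pos hLk 2).ne']

end Member240

/-! ## §3 (2.41) for `Δ_k(T_η,u)` at a general small-plaquette `u`, every `Λ`, constants chosen before the instance -/

section Member241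

/-- kernel: `[y₁ = y₂] ≤ e^{−δ|y₁−y₂|}`. [folklore] -/
private theorem ite_le_exp (P : Params) (j : ℕ) (δ : ℝ) (y₁ y₂ : Balaban1983to89.Site P j) :
    (if y₁ = y₂ then (1 : ℝ) else 0) ≤ Real.exp (-(δ * B5Ineq137Torus.T P j y₁ y₂)) := by
  split_ifs with h
  · rw [h, B5Ineq137Torus.T_self, mul_zero, neg_zero, Real.exp_zero]
  · exact (Real.exp_pos _).le

/-- **(2.41) FOR THE TORUS FORM `C^{(k)}(T,u)|_Λ = [(Δ_k(T,u) + (A/a_k)κ̂P(u_k))|_Λ]^{−1}` AT A GENERAL SMALL-PLAQUETTE BACKGROUND, EVERY `Λ`,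
CONSTANTS CHOSEN BEFORE THE INSTANCE** (*"by (2.38), C^{(k)}_Λ(u)^{−1} is bounded below and a random walk expansion as in [6] can be used to prove
that |C^{(k)}_Λ(u; x₁, x₂)| ≦ ce^{−c|x₁−x₂|}. (2.41)"*, p. 264): for every `(d, L, a, κ̂)` with `1 ≤ d ≤ 3`, `L` odd `> 1` (the scope of p27's
(1.10) engine behind (2.36)) and `κ̂ > 0` there are `θ₀, δ₁, c₂ > 0` such that, on every torus of the model, at every level `1 ≤ k ≤ K` with a
next lattice, for EVERY `U(1)` field `u` with plaquettes `‖u(∂p) − 1‖ ≤ θ`, `(L^{2k}θ)² ≤ θ₀`, averaged field `u_k = lineIter u k` with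
`‖u_k(b) − 1‖ ≤ T₁` inside the `L`-blocks of `T^{(k)}`, `‖u_k(Γ_{yx}) − 1‖ ≤ δ′`, `2(L−1)L·d·T₁² + 2δ′² ≤ ½`, and EVERY `Λ ⊆ T^{(k)}`:
**`‖C(x₁,x₂)‖ ≤ (a_k/A)·c₂·e^{−δ₁|x₁−x₂|_{T^{(k)}}}`** for all `x₁, x₂ ∈ Λ` — uniformly in `ε`, the torus, `k`, `Λ`, `u`.  Inputs BY NAME: §1 (the
(2.38)-shape at a general small-plaquette `u`), gen 19's `decay236_torus_smallField_level` ((2.36) for `Δ_k(T,u)` at small plaquettes, p27's (1.10)),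
gen 19's engine `decay241_smallField`; gen 19's `decay241_deltaRegion_smallField` is the same theorem restricted to the `bg454` backgrounds.
[cite: BalabanImbrieJaffe1988, (2.41) p.264] -/
theorem decay241_torus_smallPlaquette (d L : ℕ) (hd : 1 ≤ d) (hd3 : d ≤ 3) (hL : Odd L ∧ 1 < L) {a : ℝ} (ha : 0 < a)
    {κ' : ℝ} (hκ' : 0 < κ') :
    ∃ θ₀ δ₁ c₂ : ℝ, 0 < θ₀ ∧ 0 < δ₁ ∧ 0 < c₂ ∧ ∀ (P : Params), P.d = d → P.L = L →
      ∀ k : ℕ, 1 ≤ k → k ≤ P.K → k + 1 ≤ P.m + P.K →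
      ∀ (U : GaugeField P 0 U1) (θ : ℝ), (∀ (y : Balaban1983to89.Site P 0) (μ ν : Fin P.d), ‖plaqC U y μ ν - 1‖ ≤ θ) →
        (((P.L : ℝ) ^ k) ^ 2 * θ) ^ 2 ≤ θ₀ →
      ∀ T₁ δ' : ℝ, (∀ B : PBond P (0 + k), blkIter 1 B.src = blkIter 1 B.tgt → ‖toC (lineIter U k B) - 1‖ ≤ T₁) →
        (∀ x : Balaban1983to89.Site P (0 + k), ‖holCK (lineIter U k) 1 x - 1‖ ≤ δ') →
        2 * (((P.L : ℝ) - 1) * P.L) * P.d * T₁ ^ 2 + 2 * δ' ^ 2 ≤ 1 / 2 →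
      ∀ (Λ : Finset (Balaban1983to89.Site P (0 + k))) (x₁ x₂ : ↥Λ),
        ‖(compress Λ (op240 (deltaRegion (B1RG242Torus.α P a k * (P.L : ℝ) ^ (k * P.d)) P.eps⁻¹ U k univ)
            ((B1RG242Torus.α P a k * (P.L : ℝ) ^ (k * P.d)) / B1.aSeq a P.L k * κ') (lineIter U k)))⁻¹ x₁ x₂‖ ≤
          ((B1RG242Torus.α P a k * (P.L : ℝ) ^ (k * P.d)) / B1.aSeq a P.L k)⁻¹ * c₂ *
            Real.exp (-(δ₁ * B5Ineq137Torus.T P (0 + k) x₁ x₂)) := by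
  obtain ⟨δ₀, c₀, hδ₀, hc₀, H236⟩ := decay236_torus_smallField_level d L hd hd3 hL ha
  have hdr1 : (1 : ℝ) ≤ d := by exact_mod_cast hd
  have hL2 : 2 ≤ L := hL.2
  have hLr2 : (2 : ℝ) ≤ L := by exact_mod_cast hL2
  -- the k-uniform constants (opaque abbreviations with their defining equations)
  obtain ⟨g0, hg0⟩ : ∃ x : ℝ, x = min (a / (9 * ((d : ℝ) + 1))) (1 / 12) := ⟨_, rfl⟩
  obtain ⟨cS, hcS⟩ : ∃ x : ℝ, x = min (g0 / (2 * (((L : ℝ) - 1) * L))) (κ' / (2 * (L : ℝ) ^ d)) := ⟨_, rfl⟩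
  obtain ⟨Z, hZ⟩ : ∃ x : ℝ, x = 4 / 3 * (d : ℝ) ^ 4 := ⟨_, rfl⟩
  obtain ⟨θ₀, hθ₀⟩ : ∃ x : ℝ, x = min (1 / (2 * (d : ℝ) ^ 3)) (cS / (4 * (Z + 1))) := ⟨_, rfl⟩
  obtain ⟨W, hW⟩ : ∃ x : ℝ, x = 4 / δ₀ * (2 * B4Sect5Proof.latticeConst d (δ₀ / 2)) := ⟨_, rfl⟩
  obtain ⟨c0T, hc0T⟩ : ∃ x : ℝ, x = a * (1 + a * c₀) + κ' * ((((L : ℝ) ^ d)⁻¹) ^ 2 * Real.exp (δ₀ * ((L : ℝ) - 1))) := ⟨_, rfl⟩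
  obtain ⟨θS, hθS⟩ : ∃ x : ℝ, x = min (δ₀ / 4) (cS / (8 * (c0T * W + 1))) := ⟨_, rfl⟩
  have hg00 : 0 < g0 := by rw [hg0]; exact lt_min (by positivity) (by norm_num)
  have hLL : (0 : ℝ) < 2 * (((L : ℝ) - 1) * L) := by nlinarith
  have hcS0 : 0 < cS := by rw [hcS]; exact lt_min (div_pos hg00 hLL) (by positivity)
  have hZ0 : 0 ≤ Z := by rw [hZ]; positivity
  have hθ₀0 : 0 < θ₀ := by rw [hθ₀]; exact lt_min (by positivity) (by positivity)
  have hW0 : 0 ≤ W := by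
    have := B4Sect5Proof.latticeConst_nonneg d (half_pos hδ₀).le
    rw [hW]; positivity
  have hc0T0 : 0 < c0T := by rw [hc0T]; positivity
  have hθS0 : 0 < θS := by rw [hθS]; exact lt_min (by positivity) (by positivity)
  have hθ4 : θS ≤ δ₀ / 4 := by rw [hθS]; exact min_le_left _ _
  have hθc : θS ≤ cS / (8 * (c0T * W + 1)) := by rw [hθS]; exact min_le_right _ _
  refine ⟨θ₀, θS, 16 / cS, hθ₀0, hθS0, by positivity, ?_⟩
  intro P hPd hPL k hk1 hkK hk' U θ hθ hτ T₁ δ' hInt hTree hσ Λ x₁ x₂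
  have hLr : (P.L : ℝ) = (L : ℝ) := by rw [hPL]
  have hdr : (P.d : ℝ) = (d : ℝ) := by rw [hPd]
  have hj : (0 + k) + 1 ≤ P.m + P.K := by rw [Nat.zero_add]; exact hk'
  have hk0 : 0 + k ≤ P.m + P.K := by rw [Nat.zero_add]; exact (Nat.le_succ k).trans hk'
  -- the two smallness consequences of `(L^{2k}θ)² ≤ θ₀`
  have hτa : (((P.L : ℝ) ^ k) ^ 2 * θ) ^ 2 ≤ 1 / (2 * (d : ℝ) ^ 3) := hτ.trans (by rw [hθ₀]; exact min_le_left _ _)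
  have hτb : (((P.L : ℝ) ^ k) ^ 2 * θ) ^ 2 ≤ cS / (4 * (Z + 1)) := hτ.trans (by rw [hθ₀]; exact min_le_right _ _)
  have hτ2d : 2 * (P.d : ℝ) ^ 3 * (((P.L : ℝ) ^ k) ^ 2 * θ) ^ 2 ≤ 1 := by
    rw [hdr]
    have hpos : (0 : ℝ) < 2 * (d : ℝ) ^ 3 := by positivity
    calc 2 * (d : ℝ) ^ 3 * (((P.L : ℝ) ^ k) ^ 2 * θ) ^ 2 ≤ 2 * (d : ℝ) ^ 3 * (1 / (2 * (d : ℝ) ^ 3)) := mul_le_mul_of_nonneg_left hτa hpos.le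
      _ = 1 := by field_simp
  -- the normalization constants
  have hak0 : 0 < B1.aSeq a P.L k := B1.aSeq_pos ha (B1RG242Torus.one_lt_cast_L P) hk1
  have hα : 0 < B1RG242Torus.α P a k := mul_pos hak0 (inv_pos.mpr (pow_pos (P.spacing_pos k) 2))
  have hA0 : 0 < B1RG242Torus.α P a k * (P.L : ℝ) ^ (k * P.d) := mul_pos hα (pow_pos P.cast_L_pos _)
  have hak_le' : B1.aSeq a P.L k ≤ a := B1.aSeq_le ha (B1RG242Torus.one_lt_cast_L P) k hk1
  -- the two printed inputs, raw
  have h238raw := fun φ => ineq238_torus_smallPlaquette hk1 hk0 ha U hθ φ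
  have h236raw := H236 P hPd hPL k hk1 hkK U θ hθ hτ2d
  clear H236
  obtain ⟨A, hAdef⟩ : ∃ x : ℝ, x = B1RG242Torus.α P a k * (P.L : ℝ) ^ (k * P.d) := ⟨_, rfl⟩
  obtain ⟨ak, hakdef⟩ : ∃ x : ℝ, x = B1.aSeq a P.L k := ⟨_, rfl⟩
  rw [← hAdef, ← hakdef] at h238raw h236raw ⊢
  rw [← hAdef] at hA0
  rw [← hakdef] at hak0 hak_le'
  obtain ⟨s, hsdef⟩ : ∃ x : ℝ, x = A / ak := ⟨_, rfl⟩
  rw [← hsdef] at h238raw ⊢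
  have hs0 : 0 < s := by rw [hsdef]; exact div_pos hA0 hak0
  have hsak : s * ak = A := by rw [hsdef]; field_simp
  -- the (2.38)-shape with `γ = s·g0`, `E = s·Z·τ²`
  obtain ⟨τ2, hτ2def⟩ : ∃ x : ℝ, x = (((P.L : ℝ) ^ k) ^ 2 * θ) ^ 2 := ⟨_, rfl⟩
  rw [← hτ2def] at hτb
  have hτ2n : 0 ≤ τ2 := by rw [hτ2def]; positivity
  obtain ⟨E, hE⟩ : ∃ x : ℝ, x = s * (Z * τ2) := ⟨_, rfl⟩
  have h238 : ∀ φ : Balaban1983to89.Site P (0 + k) → ℂ, (∀ x ∉ Λ, φ x = 0) →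
      s * g0 * ∑ B : PBond P (0 + k), ‖toC (lineIter U k B) * φ B.tgt - φ B.src‖ ^ 2 - E * ∑ x, ‖φ x‖ ^ 2 ≤
        (star φ ⬝ᵥ (deltaRegion A P.eps⁻¹ U k univ *ᵥ φ)).re := by
    intro φ _
    have h := h238raw φ
    rw [hdr, ← hg0, ← hτ2def] at h
    have e : s * (g0 * ∑ B : PBond P (0 + k), ‖toC (lineIter U k B) * φ B.tgt - φ B.src‖ ^ 2
          - 4 / 3 * (d : ℝ) ^ 4 * τ2 * ∑ x, ‖φ x‖ ^ 2)
        = s * g0 * ∑ B : PBond P (0 + k), ‖toC (lineIter U k B) * φ B.tgt - φ B.src‖ ^ 2 - E * ∑ x, ‖φ x‖ ^ 2 := by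
      rw [hE, hZ]; ring
    rw [← e]; exact h
  -- the Poincaré constant and the coercivity margin
  have hc240S : c240 P g0 κ' = cS := by rw [c240, hLr, hPd, hcS]
  have hcv : c240 P (s * g0) (s * κ') = s * cS := by rw [c240_smul P hs0.le, hc240S]
  have hEle : E ≤ s * cS / 4 := by
    have h1 : Z * τ2 ≤ cS / 4 := by
      have h2 : Z * τ2 ≤ Z * (cS / (4 * (Z + 1))) := mul_le_mul_of_nonneg_left hτb hZ0
      have h3 : Z * (cS / (4 * (Z + 1))) ≤ cS / 4 := by
        rw [mul_div_assoc', div_le_div_iff₀ (by positivity) (by norm_num : (0 : ℝ) < 4)]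
        have e4 : cS * (4 * (Z + 1)) = Z * cS * 4 + 4 * cS := by ring
        rw [e4]
        linarith only [hcS0.le]
      linarith only [h2, h3]
    rw [hE]
    have := mul_le_mul_of_nonneg_left h1 hs0.le
    linarith only [this]
  have hγco : s * cS / 4 ≤ c240 P (s * g0) (s * κ') * (1 - 1 / 2) - E := by rw [hcv]; linarith only [hEle]
  have hγco0 : 0 < s * cS / 4 := by positivity
  have hElt : E < c240 P (s * g0) (s * κ') * (1 - 1 / 2) := by linarith only [hγco, hγco0]
  -- the kernel bound (2.36) at the small-plaquette field
  obtain ⟨cΔ, hcΔ⟩ : ∃ x : ℝ, x = A * (1 + ak * c₀) := ⟨_, rfl⟩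
  have hcΔ0 : 0 ≤ cΔ := by rw [hcΔ]; positivity
  have hker : ∀ y₁ ∈ Λ, ∀ y₂ ∈ Λ,
      ‖deltaRegion A P.eps⁻¹ U k univ y₁ y₂‖ ≤ cΔ * Real.exp (-(δ₀ * B5Ineq137Torus.T P (0 + k) y₁ y₂)) := by
    intro y₁ _ y₂ _
    refine (h236raw y₁ y₂).trans ?_
    have he := ite_le_exp P (0 + k) δ₀ y₁ y₂
    calc A * ((if y₁ = y₂ then 1 else 0) + ak * c₀ * Real.exp (-(δ₀ * B5Ineq137Torus.T P (0 + k) y₁ y₂)))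
        ≤ A * (Real.exp (-(δ₀ * B5Ineq137Torus.T P (0 + k) y₁ y₂)) + ak * c₀ * Real.exp (-(δ₀ * B5Ineq137Torus.T P (0 + k) y₁ y₂))) :=
          mul_le_mul_of_nonneg_left (add_le_add he le_rfl) hA0.le
      _ = cΔ * Real.exp (-(δ₀ * B5Ineq137Torus.T P (0 + k) y₁ y₂)) := by rw [hcΔ]; ring
  -- the smallness condition of the engine
  obtain ⟨ct, hct⟩ : ∃ x : ℝ, x = cΔ + s * κ' * (((P.L : ℝ) ^ P.d)⁻¹) ^ 2 * Real.exp (δ₀ * ((P.L : ℝ) - 1)) := ⟨_, rfl⟩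
  have hct_le : ct ≤ s * c0T := by
    have h1 : cΔ = s * (ak * (1 + ak * c₀)) := by rw [hcΔ, ← hsak]; ring
    have h2 : ak * (1 + ak * c₀) ≤ a * (1 + a * c₀) := by
      have h22 : 0 ≤ 1 + ak * c₀ := by positivity
      calc ak * (1 + ak * c₀) ≤ a * (1 + ak * c₀) := mul_le_mul_of_nonneg_right hak_le' h22
        _ ≤ a * (1 + a * c₀) := by gcongr
    have h3 : (((P.L : ℝ) ^ P.d)⁻¹) ^ 2 * Real.exp (δ₀ * ((P.L : ℝ) - 1)) = ((((L : ℝ) ^ d)⁻¹) ^ 2) * Real.exp (δ₀ * ((L : ℝ) - 1)) := by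
      rw [hPd, hLr]
    have h4 : s * κ' * (((P.L : ℝ) ^ P.d)⁻¹) ^ 2 * Real.exp (δ₀ * ((P.L : ℝ) - 1)) =
        s * (κ' * (((((L : ℝ) ^ d)⁻¹) ^ 2) * Real.exp (δ₀ * ((L : ℝ) - 1)))) := by
      rw [mul_assoc (s * κ'), h3, mul_assoc]
    rw [hct, h1, h4, hc0T, ← mul_add]
    exact mul_le_mul_of_nonneg_left (add_le_add h2 le_rfl) hs0.le
  have hwC : weightC (fun t => 2 * B4Sect5Proof.latticeConst P.d t) ct δ₀ = ct * W := by
    rw [B4Sect5Torus.weightC, hW, hPd]; ring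
  have hct0 : 0 ≤ ct := by rw [hct]; positivity
  have hsmall : θS * weightC (fun t => 2 * B4Sect5Proof.latticeConst P.d t) ct δ₀ ≤ (c240 P (s * g0) (s * κ') * (1 - 1 / 2) - E) / 2 := by
    rw [hwC]
    have h2 : θS * (ct * W) ≤ cS / (8 * (c0T * W + 1)) * (s * c0T * W) := by
      have : ct * W ≤ s * c0T * W := mul_le_mul_of_nonneg_right hct_le hW0
      exact mul_le_mul hθc this (by positivity) (by positivity)
    have h3 : cS / (8 * (c0T * W + 1)) * (s * c0T * W) ≤ s * cS / 8 := by
      have hden : 0 < 8 * (c0T * W + 1) := by positivity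
      rw [div_mul_eq_mul_div, div_le_div_iff₀ hden (by norm_num : (0 : ℝ) < 8)]
      have e1 : cS * (s * c0T * W) * 8 = s * cS * (8 * (c0T * W + 1)) - 8 * (s * cS) := by ring
      rw [e1]
      have h4 : 0 ≤ 8 * (s * cS) := by positivity
      linarith only [h4]
    linarith only [h2, h3, hγco]
  have hmain := decay241_smallField hj (lineIter U k) hInt hTree hσ (mul_nonneg hs0.le hg00.le) (mul_nonneg hs0.le hκ'.le) hElt h238 hcΔ0
    hδ₀ hker hθS0.le hθ4 (by rw [← hct]; exact hsmall) x₁ x₂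
  refine hmain.trans ?_
  have he0 : 0 ≤ Real.exp (-(θS * B5Ineq137Torus.T P (0 + k) x₁ x₂)) := (Real.exp_pos _).le
  refine mul_le_mul_of_nonneg_right ?_ he0
  calc 4 / (c240 P (s * g0) (s * κ') * (1 - 1 / 2) - E) ≤ 4 / (s * cS / 4) := div_le_div_of_nonneg_left (by norm_num) hγco0 hγco
    _ = s⁻¹ * (16 / cS) := by field_simp; ring

/-- **(2.41) VERBATIM SHAPE** `|C^{(k)}(u; x₁, x₂)| ≦ ce^{−c|x₁−x₂|}` for the torus form at a general small-plaquette `u`: the bound of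
`decay241_torus_smallPlaquette` with the factor `(A/a_k)^{−1} ≤ 1` dropped (gen 19's `one_le_ratio`). [cite: BalabanImbrieJaffe1988, (2.41) p.264] -/
theorem decay241_torus_smallPlaquette_printed (d L : ℕ) (hd : 1 ≤ d) (hd3 : d ≤ 3) (hL : Odd L ∧ 1 < L) {a : ℝ} (ha : 0 < a)
    {κ' : ℝ} (hκ' : 0 < κ') :
    ∃ θ₀ δ₁ c₂ : ℝ, 0 < θ₀ ∧ 0 < δ₁ ∧ 0 < c₂ ∧ ∀ (P : Params), P.d = d → P.L = L →
      ∀ k : ℕ, 1 ≤ k → k ≤ P.K → k + 1 ≤ P.m + P.K →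
      ∀ (U : GaugeField P 0 U1) (θ : ℝ), (∀ (y : Balaban1983to89.Site P 0) (μ ν : Fin P.d), ‖plaqC U y μ ν - 1‖ ≤ θ) →
        (((P.L : ℝ) ^ k) ^ 2 * θ) ^ 2 ≤ θ₀ →
      ∀ T₁ δ' : ℝ, (∀ B : PBond P (0 + k), blkIter 1 B.src = blkIter 1 B.tgt → ‖toC (lineIter U k B) - 1‖ ≤ T₁) →
        (∀ x : Balaban1983to89.Site P (0 + k), ‖holCK (lineIter U k) 1 x - 1‖ ≤ δ') →
        2 * (((P.L : ℝ) - 1) * P.L) * P.d * T₁ ^ 2 + 2 * δ' ^ 2 ≤ 1 / 2 →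
      ∀ (Λ : Finset (Balaban1983to89.Site P (0 + k))) (x₁ x₂ : ↥Λ),
        ‖(compress Λ (op240 (deltaRegion (B1RG242Torus.α P a k * (P.L : ℝ) ^ (k * P.d)) P.eps⁻¹ U k univ)
            ((B1RG242Torus.α P a k * (P.L : ℝ) ^ (k * P.d)) / B1.aSeq a P.L k * κ') (lineIter U k)))⁻¹ x₁ x₂‖ ≤
          c₂ * Real.exp (-(δ₁ * B5Ineq137Torus.T P (0 + k) x₁ x₂)) := by
  obtain ⟨θ₀, δ₁, c₂, hθ₀, hδ₁, hc₂, H⟩ := decay241_torus_smallPlaquette d L hd hd3 hL ha hκ'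
  refine ⟨θ₀, δ₁, c₂, hθ₀, hδ₁, hc₂, ?_⟩
  intro P hPd hPL k hk1 hkK hk' U θ hθ hτ T₁ δ' hInt hTree hσ Λ x₁ x₂
  refine (H P hPd hPL k hk1 hkK hk' U θ hθ hτ T₁ δ' hInt hTree hσ Λ x₁ x₂).trans ?_
  have hs : (B1RG242Torus.α P a k * (P.L : ℝ) ^ (k * P.d) / B1.aSeq a P.L k)⁻¹ ≤ 1 :=
    inv_le_one_of_one_le₀ (one_le_ratio P ha hk1 hkK)
  have he : 0 ≤ Real.exp (-(δ₁ * B5Ineq137Torus.T P (0 + k) x₁ x₂)) := (Real.exp_pos _).le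
  calc (B1RG242Torus.α P a k * (P.L : ℝ) ^ (k * P.d) / B1.aSeq a P.L k)⁻¹ * c₂ * Real.exp (-(δ₁ * B5Ineq137Torus.T P (0 + k) x₁ x₂))
      ≤ 1 * c₂ * Real.exp (-(δ₁ * B5Ineq137Torus.T P (0 + k) x₁ x₂)) :=
        mul_le_mul_of_nonneg_right (mul_le_mul_of_nonneg_right hs hc₂.le) he
    _ = c₂ * Real.exp (-(δ₁ * B5Ineq137Torus.T P (0 + k) x₁ x₂)) := by ring

/-- **(2.41) FOR `C^{(k)}(T, e^{ieεA})|_Λ` AT A (2.23)-REGULAR `A`, EVERY `Λ`** ([I] p. 326 *«exp[ie_kηA], where A is smooth and small»*):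
`decay241_torus_smallPlaquette` with the plaquette condition discharged by regularity (`(2c·e_k^β)² ≤ θ₀`, gen 21's plaquette size
`2c·e_k^β/L^{2k}`); the averaged-field smallness of `u_k` displayed. [cite: BalabanImbrieJaffe1988, (2.41) p.264] -/
theorem decay241_regular_torus (d L : ℕ) (hd : 1 ≤ d) (hd3 : d ≤ 3) (hL : Odd L ∧ 1 < L) {a : ℝ} (ha : 0 < a) {κ' : ℝ} (hκ' : 0 < κ')
    (e creg β : ℝ) :
    ∃ θ₀ δ₁ c₂ : ℝ, 0 < θ₀ ∧ 0 < δ₁ ∧ 0 < c₂ ∧ ∀ (P : Params), P.d = d → P.L = L →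
      ∀ k : ℕ, 1 ≤ k → k ≤ P.K → k + 1 ≤ P.m + P.K →
      ∀ (A : PBond P 0 → ℝ) (ec : ℝ), 0 < ec →
      (∀ (z : Balaban1983to89.Site P 0) (μ ν : Fin P.d),
          P.spacing k * |e| / ec * |A ⟨z.shift μ, ν⟩ - A ⟨z, ν⟩| ≤ creg * ec ^ (β - 1) / (L : ℝ) ^ k) →
      (2 * creg * ec ^ β) ^ 2 ≤ θ₀ →
      ∀ T₁ δ' : ℝ, (∀ B : PBond P (0 + k), blkIter 1 B.src = blkIter 1 B.tgt → ‖toC (lineIter (expGauge P e A) k B) - 1‖ ≤ T₁) →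
        (∀ x : Balaban1983to89.Site P (0 + k), ‖holCK (lineIter (expGauge P e A) k) 1 x - 1‖ ≤ δ') →
        2 * (((P.L : ℝ) - 1) * P.L) * P.d * T₁ ^ 2 + 2 * δ' ^ 2 ≤ 1 / 2 →
      ∀ (Λ : Finset (Balaban1983to89.Site P (0 + k))) (x₁ x₂ : ↥Λ),
        ‖(compress Λ (op240 (deltaRegion (B1RG242Torus.α P a k * (P.L : ℝ) ^ (k * P.d)) P.eps⁻¹ (expGauge P e A) k univ)
            ((B1RG242Torus.α P a k * (P.L : ℝ) ^ (k * P.d)) / B1.aSeq a P.L k * κ') (lineIter (expGauge P e A) k)))⁻¹ x₁ x₂‖ ≤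
          ((B1RG242Torus.α P a k * (P.L : ℝ) ^ (k * P.d)) / B1.aSeq a P.L k)⁻¹ * c₂ *
            Real.exp (-(δ₁ * B5Ineq137Torus.T P (0 + k) x₁ x₂)) := by
  obtain ⟨θ₀, δ₁, c₂, hθ₀, hδ₁, hc₂, H⟩ := decay241_torus_smallPlaquette d L hd hd3 hL ha hκ'
  refine ⟨θ₀, δ₁, c₂, hθ₀, hδ₁, hc₂, ?_⟩
  intro P hPd hPL k hk1 hkK hk' A ec hec hreg hsmall T₁ δ' hInt hTree hσ Λ x₁ x₂
  subst hPL
  have hLk : (0 : ℝ) < (P.L : ℝ) ^ k := pow_pos P.cast_L_pos k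
  refine H P hPd rfl k hk1 hkK hk' (expGauge P e A) (2 * creg * ec ^ β / ((P.L : ℝ) ^ k) ^ 2)
    (fun y μ ν => norm_plaqC_expGauge_sub_one_le_of_regular (k := k) hec hreg y μ ν) ?_ T₁ δ' hInt hTree hσ Λ x₁ x₂
  rwa [mul_div_cancel₀ _ (pow_pos hLk 2).ne']

/-- **(2.41) FOR `C^{(k)}(T, e^{ieεA})|_Λ` AT A (2.23)-REGULAR AND BOUNDED `A`** (*«A is smooth and small»*): `decay241_regular_torus` with the
averaged-field smallness supplied by a sup bound `‖A‖_∞ ≤ A_∞` — `T₁ = L^kε|e|A_∞`, `δ′ = d(L−1)T₁` (gen 21's `norm_toC_lineIter_expGauge_sub_one_le` /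
`norm_holCK_one_sub_one_le`), so the only conditions on the field are `(2c·e_k^β)² ≤ θ₀` and `2(L−1)L·d·T₁² + 2δ′² ≤ ½` with these values.
[cite: BalabanImbrieJaffe1988, (2.41) p.264] -/
theorem decay241_regular_torus_of_sup (d L : ℕ) (hd : 1 ≤ d) (hd3 : d ≤ 3) (hL : Odd L ∧ 1 < L) {a : ℝ} (ha : 0 < a) {κ' : ℝ}
    (hκ' : 0 < κ') (e creg β : ℝ) :
    ∃ θ₀ δ₁ c₂ : ℝ, 0 < θ₀ ∧ 0 < δ₁ ∧ 0 < c₂ ∧ ∀ (P : Params), P.d = d → P.L = L →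
      ∀ k : ℕ, 1 ≤ k → k ≤ P.K → k + 1 ≤ P.m + P.K →
      ∀ (A : PBond P 0 → ℝ) (ec : ℝ), 0 < ec →
      (∀ (z : Balaban1983to89.Site P 0) (μ ν : Fin P.d),
          P.spacing k * |e| / ec * |A ⟨z.shift μ, ν⟩ - A ⟨z, ν⟩| ≤ creg * ec ^ (β - 1) / (L : ℝ) ^ k) →
      (2 * creg * ec ^ β) ^ 2 ≤ θ₀ →
      ∀ (Asup : ℝ), (∀ b, |A b| ≤ Asup) →
        2 * (((P.L : ℝ) - 1) * P.L) * P.d * (P.spacing k * |e| * Asup) ^ 2 +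
          2 * (P.d * ((P.L : ℝ) - 1) * (P.spacing k * |e| * Asup)) ^ 2 ≤ 1 / 2 →
      ∀ (Λ : Finset (Balaban1983to89.Site P (0 + k))) (x₁ x₂ : ↥Λ),
        ‖(compress Λ (op240 (deltaRegion (B1RG242Torus.α P a k * (P.L : ℝ) ^ (k * P.d)) P.eps⁻¹ (expGauge P e A) k univ)
            ((B1RG242Torus.α P a k * (P.L : ℝ) ^ (k * P.d)) / B1.aSeq a P.L k * κ') (lineIter (expGauge P e A) k)))⁻¹ x₁ x₂‖ ≤
          ((B1RG242Torus.α P a k * (P.L : ℝ) ^ (k * P.d)) / B1.aSeq a P.L k)⁻¹ * c₂ *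
            Real.exp (-(δ₁ * B5Ineq137Torus.T P (0 + k) x₁ x₂)) := by
  obtain ⟨θ₀, δ₁, c₂, hθ₀, hδ₁, hc₂, H⟩ := decay241_regular_torus d L hd hd3 hL ha hκ' e creg β
  refine ⟨θ₀, δ₁, c₂, hθ₀, hδ₁, hc₂, ?_⟩
  intro P hPd hPL k hk1 hkK hk' A ec hec hreg hsmall Asup hsup hσ Λ x₁ x₂
  have hk : 0 + k ≤ P.m + P.K := by omega
  exact H P hPd hPL k hk1 hkK hk' A ec hec hreg hsmall _ _
    (fun b _ => norm_toC_lineIter_expGauge_sub_one_le hk e hsup b)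
    (norm_holCK_one_sub_one_le (lineIter (expGauge P e A) k) fun b => norm_toC_lineIter_expGauge_sub_one_le hk e hsup b)
    hσ Λ x₁ x₂

end Member241

/-! ## §4 At every gauge transform `u^h`: [I] p. 326 *«by change of gauge u_k can be transformed … into a configuration of the form exp[ie_kηA]»* -/

section GaugeAct

variable {S : Type*} [Fintype S] [DecidableEq S]

/-- kernel: restriction to `Λ` commutes with a diagonal conjugation. [folklore] -/
private theorem compress_sandwich (Λ : Finset S) (m : S → ℂ) (X : Matrix S S ℂ) :
    compress Λ (diagonal m * X * (diagonal m)ᴴ) = diagonal (fun i : ↥Λ => m i) * compress Λ X * (diagonal (fun i : ↥Λ => m i))ᴴ := by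
  ext i l
  simp only [compress, submatrix_apply, diagonal_conjTranspose, mul_diagonal, diagonal_mul, Pi.star_apply]

/-- kernel: conjugation by a diagonal of phases preserves the absolute values of the entries of the inverse. [folklore] -/
private theorem norm_inv_sandwich_apply (m : S → ℂ) (hm : ∀ i, ‖m i‖ = 1) (Y : Matrix S S ℂ) (i l : S) :
    ‖(diagonal m * Y * (diagonal m)ᴴ)⁻¹ i l‖ = ‖Y⁻¹ i l‖ := by
  have hmm : ∀ i, m i * (starRingEnd ℂ) (m i) = 1 := fun i => by
    rw [Complex.mul_conj, Complex.normSq_eq_norm_sq, hm, one_pow, Complex.ofReal_one]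
  have h1 : (diagonal m)ᴴ * diagonal m = 1 := by
    rw [diagonal_conjTranspose, diagonal_mul_diagonal, ← diagonal_one]
    congr 1; funext i; rw [Pi.star_apply, Complex.star_def, mul_comm, hmm]
  have h2 : diagonal m * (diagonal m)ᴴ = 1 := by
    rw [diagonal_conjTranspose, diagonal_mul_diagonal, ← diagonal_one]
    congr 1; funext i; rw [Pi.star_apply, Complex.star_def, hmm]
  have hinv : (diagonal m)⁻¹ = (diagonal m)ᴴ := Matrix.inv_eq_left_inv h1
  have hinv' : ((diagonal m)ᴴ)⁻¹ = diagonal m := Matrix.inv_eq_left_inv h2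
  rw [Matrix.mul_inv_rev, Matrix.mul_inv_rev, hinv, hinv', ← Matrix.mul_assoc, diagonal_conjTranspose, mul_diagonal, diagonal_mul, norm_mul,
    norm_mul, Pi.star_apply, Complex.star_def, Complex.norm_conj, hm, hm, one_mul, mul_one]

/-- **(2.41) FOR THE TORUS FORM AT EVERY GAUGE TRANSFORM `u^h` OF A SMALL-PLAQUETTE `u`** — the constants `(θ₀, δ₁, c₂)` and the hypotheses of
`decay241_torus_smallPlaquette` on `u` (plaquettes — gauge invariant — and the averaged-field smallness of `u_k = lineIter u k` for THIS
representative), the conclusion for `C = [(Δ_k(T,u^h) + (A/a_k)κ̂P((u^h)_k))|_Λ]^{−1}`, EVERY `h : T_ε → U(1)` (`(u^h)_k = (u_k)^{h∘corner}` by (2.8),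
`lineIter_gaugeAct`; the operator is conjugated by the diagonal unitary `M^{(k)}_h`, gen 19's `op240_deltaRegion_gaugeAct`, so the kernel of the
inverse keeps its absolute values): **`‖C(x₁,x₂)‖ ≤ (a_k/A)·c₂·e^{−δ₁|x₁−x₂|_{T^{(k)}}}`**. [cite: BalabanImbrieJaffe1988, (2.41) p.264]
[cite: BalabanImbrieJaffe1985, (6.3.2) p.320] -/
theorem decay241_torus_smallPlaquette_gaugeAct (d L : ℕ) (hd : 1 ≤ d) (hd3 : d ≤ 3) (hL : Odd L ∧ 1 < L) {a : ℝ} (ha : 0 < a)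
    {κ' : ℝ} (hκ' : 0 < κ') :
    ∃ θ₀ δ₁ c₂ : ℝ, 0 < θ₀ ∧ 0 < δ₁ ∧ 0 < c₂ ∧ ∀ (P : Params), P.d = d → P.L = L →
      ∀ k : ℕ, 1 ≤ k → k ≤ P.K → k + 1 ≤ P.m + P.K →
      ∀ (U : GaugeField P 0 U1) (θ : ℝ), (∀ (y : Balaban1983to89.Site P 0) (μ ν : Fin P.d), ‖plaqC U y μ ν - 1‖ ≤ θ) →
        (((P.L : ℝ) ^ k) ^ 2 * θ) ^ 2 ≤ θ₀ →
      ∀ T₁ δ' : ℝ, (∀ B : PBond P (0 + k), blkIter 1 B.src = blkIter 1 B.tgt → ‖toC (lineIter U k B) - 1‖ ≤ T₁) →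
        (∀ x : Balaban1983to89.Site P (0 + k), ‖holCK (lineIter U k) 1 x - 1‖ ≤ δ') →
        2 * (((P.L : ℝ) - 1) * P.L) * P.d * T₁ ^ 2 + 2 * δ' ^ 2 ≤ 1 / 2 →
      ∀ (h : GaugeTransf P 0 U1) (Λ : Finset (Balaban1983to89.Site P (0 + k))) (x₁ x₂ : ↥Λ),
        ‖(compress Λ (op240 (deltaRegion (B1RG242Torus.α P a k * (P.L : ℝ) ^ (k * P.d)) P.eps⁻¹ (gaugeAct h U) k univ)
            ((B1RG242Torus.α P a k * (P.L : ℝ) ^ (k * P.d)) / B1.aSeq a P.L k * κ') (lineIter (gaugeAct h U) k)))⁻¹ x₁ x₂‖ ≤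
          ((B1RG242Torus.α P a k * (P.L : ℝ) ^ (k * P.d)) / B1.aSeq a P.L k)⁻¹ * c₂ *
            Real.exp (-(δ₁ * B5Ineq137Torus.T P (0 + k) x₁ x₂)) := by
  obtain ⟨θ₀, δ₁, c₂, hθ₀, hδ₁, hc₂, H⟩ := decay241_torus_smallPlaquette d L hd hd3 hL ha hκ'
  refine ⟨θ₀, δ₁, c₂, hθ₀, hδ₁, hc₂, ?_⟩
  intro P hPd hPL k hk1 hkK hk' U θ hθ hτ T₁ δ' hInt hTree hσ h Λ x₁ x₂
  have hk0 : 0 + k ≤ P.m + P.K := by rw [Nat.zero_add]; exact (Nat.le_succ k).trans hk'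
  have hj : 0 + k + 1 ≤ P.m + P.K := by rw [Nat.zero_add]; exact hk'
  have hak0 : 0 < B1.aSeq a P.L k := B1.aSeq_pos ha (B1RG242Torus.one_lt_cast_L P) hk1
  have hα : 0 < B1RG242Torus.α P a k := mul_pos hak0 (inv_pos.mpr (pow_pos (P.spacing_pos k) 2))
  have hA0 : 0 < B1RG242Torus.α P a k * (P.L : ℝ) ^ (k * P.d) := mul_pos hα (pow_pos P.cast_L_pos _)
  have e : mulOpK h k = diagonal (fun y : Balaban1983to89.Site P (0 + k) => toC (h (cornerIter k y))) := rfl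
  rw [lineIter_gaugeAct h U k hk0, op240_deltaRegion_gaugeAct hk0 hj (inv_ne_zero P.eps_pos.ne') hA0, e, compress_sandwich,
    norm_inv_sandwich_apply _ (fun i => BIJ88Sect3Statements.norm_toC _)]
  exact H P hPd hPL k hk1 hkK hk' U θ hθ hτ T₁ δ' hInt hTree hσ Λ x₁ x₂

/-- **(2.41) FOR THE TORUS FORM AT EVERY GAUGE TRANSFORM `u = (e^{ieεA})^h` OF A (2.23)-REGULAR CONFIGURATION** — [I] p. 326 verbatim:
*«In order to remain within the framework of this reference, we remark that by change of gauge u_k can be transformed in a local region Λ into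
a configuration of the form exp[ie_kηA], where A is smooth and small»* (here on the whole torus): the hypotheses on the representative `A`
(regularity with `(2c·e_k^β)² ≤ θ₀`, averaged-field smallness of `(e^{ieεA})_k`), the conclusion for `C = [(Δ_k(T,u) + (A/a_k)κ̂P(u_k))|_Λ]^{−1}` at
`u = (e^{ieεA})^h`, EVERY `h`, EVERY `Λ`. [cite: BalabanImbrieJaffe1988, (2.41) p.264] [cite: BalabanImbrieJaffe1985, p.326 «exp[ie_kηA]»] -/
theorem decay241_regular_torus_gaugeAct (d L : ℕ) (hd : 1 ≤ d) (hd3 : d ≤ 3) (hL : Odd L ∧ 1 < L) {a : ℝ} (ha : 0 < a) {κ' : ℝ}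
    (hκ' : 0 < κ') (e creg β : ℝ) :
    ∃ θ₀ δ₁ c₂ : ℝ, 0 < θ₀ ∧ 0 < δ₁ ∧ 0 < c₂ ∧ ∀ (P : Params), P.d = d → P.L = L →
      ∀ k : ℕ, 1 ≤ k → k ≤ P.K → k + 1 ≤ P.m + P.K →
      ∀ (A : PBond P 0 → ℝ) (ec : ℝ), 0 < ec →
      (∀ (z : Balaban1983to89.Site P 0) (μ ν : Fin P.d),
          P.spacing k * |e| / ec * |A ⟨z.shift μ, ν⟩ - A ⟨z, ν⟩| ≤ creg * ec ^ (β - 1) / (L : ℝ) ^ k) →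
      (2 * creg * ec ^ β) ^ 2 ≤ θ₀ →
      ∀ T₁ δ' : ℝ, (∀ B : PBond P (0 + k), blkIter 1 B.src = blkIter 1 B.tgt → ‖toC (lineIter (expGauge P e A) k B) - 1‖ ≤ T₁) →
        (∀ x : Balaban1983to89.Site P (0 + k), ‖holCK (lineIter (expGauge P e A) k) 1 x - 1‖ ≤ δ') →
        2 * (((P.L : ℝ) - 1) * P.L) * P.d * T₁ ^ 2 + 2 * δ' ^ 2 ≤ 1 / 2 →
      ∀ (h : GaugeTransf P 0 U1) (Λ : Finset (Balaban1983to89.Site P (0 + k))) (x₁ x₂ : ↥Λ),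
        ‖(compress Λ (op240 (deltaRegion (B1RG242Torus.α P a k * (P.L : ℝ) ^ (k * P.d)) P.eps⁻¹ (gaugeAct h (expGauge P e A)) k univ)
            ((B1RG242Torus.α P a k * (P.L : ℝ) ^ (k * P.d)) / B1.aSeq a P.L k * κ')
            (lineIter (gaugeAct h (expGauge P e A)) k)))⁻¹ x₁ x₂‖ ≤
          ((B1RG242Torus.α P a k * (P.L : ℝ) ^ (k * P.d)) / B1.aSeq a P.L k)⁻¹ * c₂ *
            Real.exp (-(δ₁ * B5Ineq137Torus.T P (0 + k) x₁ x₂)) := by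
  obtain ⟨θ₀, δ₁, c₂, hθ₀, hδ₁, hc₂, H⟩ := decay241_torus_smallPlaquette_gaugeAct d L hd hd3 hL ha hκ'
  refine ⟨θ₀, δ₁, c₂, hθ₀, hδ₁, hc₂, ?_⟩
  intro P hPd hPL k hk1 hkK hk' A ec hec hreg hsmall T₁ δ' hInt hTree hσ h Λ x₁ x₂
  subst hPL
  have hLk : (0 : ℝ) < (P.L : ℝ) ^ k := pow_pos P.cast_L_pos k
  refine H P hPd rfl k hk1 hkK hk' (expGauge P e A) (2 * creg * ec ^ β / ((P.L : ℝ) ^ k) ^ 2)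
    (fun y μ ν => norm_plaqC_expGauge_sub_one_le_of_regular (k := k) hec hreg y μ ν) ?_ T₁ δ' hInt hTree hσ h Λ x₁ x₂
  rwa [mul_div_cancel₀ _ (pow_pos hLk 2).ne']

end GaugeAct


/-! ## §5 (v1.1) The `Δ_{k,loc}` member (2.41) of `BIJ88Decay241RegularTorusCwt` at every gauge transform `(e^{ieεA})^h` -/

section GaugeActLoc

open BIJ88DeltaLoc234Torus (deltaLocT deltaLocT_gaugeAct)
open BIJ88Decay241SmallFieldTorus (pOp_gaugeAct)
open BIJ88NeumannNoZeroModesTorus (IsBlockUnion)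
open BIJ88Cutoffs21 (cutoff)
open BIJ88LocWeights227Torus (lamFam labels)
open BIJ88Close231RegularTorusCwt (cubeFamB rowMargin)
open BIJ88Decay241RegularTorusCwt (decay241_regular_torus_cwt isBlockUnion_cubeFamB)
open BIJ88DeltaLoc234Torus (mulOp)
open B4Sect5Proof (latticeConst)

variable {P : Params} {j : ℕ}

/-- **`Δ_{k,loc}(u^h) + κP((v)^{h_k}) = M^{(k)}_h(Δ_{k,loc}(u) + κP(v))M^{(k)}_hᴴ`** — the (2.39)/(2.40) operator built on the LOCALIZED form is gauge
covariant (gen 15's `deltaLocT_gaugeAct` = [I] (6.3.2) for the concrete `Δ_{k,loc}`, gen 19's `pOp_gaugeAct`), for every cube family of `k`-block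
unions and real weight / cut-off data. [cite: BalabanImbrieJaffe1988, (2.40) p.264] [cite: BalabanImbrieJaffe1985, (6.3.2) p.320] -/
theorem op240_deltaLocT_gaugeAct {k : ℕ} (hk : j + k ≤ P.m + P.K) (hk1 : j + k + 1 ≤ P.m + P.K) {a c : ℝ} (hc : c ≠ 0) (ha : 0 < a)
    (κ : ℝ) (h : GaugeTransf P j U1) (U : GaugeField P j U1) {ι : Type*} [Fintype ι] {cube : ι → Finset (Balaban1983to89.Site P j)}
    (hcube : ∀ α, IsBlockUnion k (cube α)) (lam : ι → Balaban1983to89.Site P j → Balaban1983to89.Site P j → ℝ)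
    (ζ'' : Balaban1983to89.Site P j → Balaban1983to89.Site P j → ℝ) (v : GaugeField P (j + k) U1) :
    op240 (deltaLocT a c (gaugeAct h U) k cube lam ζ'') κ (gaugeAct (fun y => h (cornerIter k y)) v) =
      mulOpK h k * op240 (deltaLocT a c U k cube lam ζ'') κ v * (mulOpK h k)ᴴ := by
  have e : mulOp (fun y => h (cornerIter k y)) = mulOpK h k := rfl
  rw [op240, op240, deltaLocT_gaugeAct hk hc ha h U hcube lam ζ'', pOp_gaugeAct hk1, e, Matrix.mul_add, Matrix.add_mul,
    Matrix.mul_smul, Matrix.smul_mul]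

/-- **(2.41) FOR `C^{(k)}_Λ(u)` BUILT ON `Δ_{k,loc}` AT EVERY GAUGE TRANSFORM `u = (e^{ieεA})^h` OF A (2.23)-REGULAR CONFIGURATION, FOR THE PRINTED
DATA WITH BIG-BLOCK CUBES** — [I] p. 326 *«by change of gauge u_k can be transformed in a local region Λ into a configuration of the form
exp[ie_kηA], where A is smooth and small»*: the constants and hypotheses of gen 21's `BIJ88Decay241RegularTorusCwt.decay241_regular_torus_cwt` on
the representative `A` (regularity, reference box, radii, deep `Λ`, averaged-field smallness, `κ′`, `hE`, `ϑ`, `hsmall`), the conclusion for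
`C = [(Δ_{k,loc}(u) + (A/a_k)κ′P(u_k))|_Λ]^{−1}` at `u = (e^{ieεA})^h`, EVERY `h : T_ε → U(1)` (`op240_deltaLocT_gaugeAct` + (2.8) `lineIter_gaugeAct`;
the diagonal unitary conjugation keeps the absolute values of the kernel of the inverse). [cite: BalabanImbrieJaffe1988, (2.41) p.264]
[cite: BalabanImbrieJaffe1985, p.326 «exp[ie_kηA]»] -/
theorem decay241_regular_torus_cwt_gaugeAct {d : ℕ} (L : ℕ) (hL : 2 ≤ L) {a : ℝ} (ha : 0 < a) (e creg β : ℝ) (hcreg : 0 ≤ creg)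
    (hβ : 0 < β) :
    ∃ s₀ : ℕ, ∀ s : ℕ, s₀ ≤ s → ∃ c₀ e₁ : ℝ, 0 < c₀ ∧ 0 < e₁ ∧
      ∀ (P : Params) (hPd : P.d = d + 1), P.L = L → ∀ (k : ℕ), 1 ≤ k → k ≤ P.K → k + s ≤ P.m + P.K → k + 1 ≤ P.m + P.K →
      3 * (L ^ k * L ^ s) ≤ P.sitesPerDir 0 →
      ∀ (A : PBond P 0 → ℝ) (ec : ℝ), 0 < ec → ec ≤ e₁ →
      (∀ (z : Balaban1983to89.Site P 0) (μ ν : Fin P.d),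
          P.spacing k * |e| / ec * |A ⟨z.shift μ, ν⟩ - A ⟨z, ν⟩| ≤ creg * ec ^ (β - 1) / (L : ℝ) ^ k) →
      ∀ (c M0 : Fin (d + 1) → ℕ), (∀ i, c i * P.L ^ k + P.L ^ k * M0 i ≤ P.sitesPerDir 0) →
      ∀ (sg W : ℕ), 1 ≤ sg → ∀ (R R₀ R₁ : ℝ), ((rowMargin L (d + 1) k s : ℕ) : ℝ) < R → 0 ≤ R₁ → R₁ < R₀ →
        2 * (sg : ℝ) / 3 + R₀ / 2 + R ≤ W → (∀ i, ((P.L ^ k * M0 i : ℕ) : ℝ) + R ≤ P.sitesPerDir 0) →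
      ∀ (Λ : Finset (Balaban1983to89.Site P (0 + k))),
        (∀ y₁ ∈ Λ, ∀ μ, (c (Fin.cast hPd μ) : ℝ) * P.L ^ k + (R₀ + R) ≤ (P.L : ℝ) ^ k * (y₁ μ).val ∧
          (P.L : ℝ) ^ k * (y₁ μ).val + P.L ^ k + (R₀ + R) ≤ (c (Fin.cast hPd μ) : ℝ) * P.L ^ k + (P.L : ℝ) ^ k * M0 (Fin.cast hPd μ)) →
      ∀ (T₁ δ' σ : ℝ),
        (∀ b : PBond P (0 + k), blkIter 1 b.src = blkIter 1 b.tgt → ‖toC (lineIter (expGauge P e A) k b) - 1‖ ≤ T₁) →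
        (∀ y : Balaban1983to89.Site P (0 + k), ‖holCK (lineIter (expGauge P e A) k) 1 y - 1‖ ≤ δ') →
        2 * (((P.L : ℝ) - 1) * P.L) * P.d * T₁ ^ 2 + 2 * δ' ^ 2 ≤ σ →
      ∀ (κ' : ℝ), 0 ≤ κ' →
        4 / 3 * (P.d : ℝ) ^ 4 * (2 * creg * ec ^ β) ^ 2 +
            B1.aSeq a P.L k ^ 2 * (c₀ * Real.exp (1 / (8 * (L : ℝ) ^ s) / 2) * latticeConst P.d (1 / (8 * (L : ℝ) ^ s) / 2)) *
              ((((⌊(((P.L : ℝ) ^ k) - 1 + R₀) / sg⌋₊ : ℝ) + 3) ^ (d + 1)) *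
                  Real.exp (-(1 / (8 * (L : ℝ) ^ s) * (((P.L : ℝ) ^ k)⁻¹ * (2 * R)))) +
                Real.exp (-(1 / (8 * (L : ℝ) ^ s) / 2 * (((P.L : ℝ) ^ k)⁻¹ * R₁)))) <
          c240 P (min (a / (9 * (P.d + 1))) (1 / 12)) κ' * (1 - σ) →
      ∀ (ϑ : ℝ), 0 ≤ ϑ → ϑ ≤ 1 / (8 * (L : ℝ) ^ s) / 4 →
        ϑ * ((4 / (1 / (8 * (L : ℝ) ^ s))) * (2 * latticeConst P.d (1 / (8 * (L : ℝ) ^ s) / 2)) *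
            (B1.aSeq a P.L k * (1 + (((⌊(((P.L : ℝ) ^ k) - 1 + R₀) / sg⌋₊ : ℝ) + 3) ^ (d + 1)) * B1.aSeq a P.L k *
                (c₀ * Real.exp (1 / (8 * (L : ℝ) ^ s)))) +
              κ' * (((P.L : ℝ) ^ P.d)⁻¹) ^ 2 * Real.exp (1 / (8 * (L : ℝ) ^ s) * ((P.L : ℝ) - 1)))) ≤
          (c240 P (min (a / (9 * (P.d + 1))) (1 / 12)) κ' * (1 - σ) -
            (4 / 3 * (P.d : ℝ) ^ 4 * (2 * creg * ec ^ β) ^ 2 +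
              B1.aSeq a P.L k ^ 2 * (c₀ * Real.exp (1 / (8 * (L : ℝ) ^ s) / 2) * latticeConst P.d (1 / (8 * (L : ℝ) ^ s) / 2)) *
                ((((⌊(((P.L : ℝ) ^ k) - 1 + R₀) / sg⌋₊ : ℝ) + 3) ^ (d + 1)) *
                    Real.exp (-(1 / (8 * (L : ℝ) ^ s) * (((P.L : ℝ) ^ k)⁻¹ * (2 * R)))) +
                  Real.exp (-(1 / (8 * (L : ℝ) ^ s) / 2 * (((P.L : ℝ) ^ k)⁻¹ * R₁)))))) / 2 →
      ∀ (h : GaugeTransf P 0 U1) (x₁ x₂ : ↥Λ),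
        ‖(compress Λ (op240 (deltaLocT (B1RG242Torus.α P a k * (P.L : ℝ) ^ (k * P.d)) P.eps⁻¹ (gaugeAct h (expGauge P e A)) k
            (cubeFamB hPd (P.L ^ k) c M0 sg W (L ^ k * L ^ s)) (lamFam hPd (P.L ^ k) c M0 sg) (cutoff R₁ R₀ (B5Ineq137Torus.T P 0)))
            ((B1RG242Torus.α P a k * (P.L : ℝ) ^ (k * P.d)) / B1.aSeq a P.L k * κ') (lineIter (gaugeAct h (expGauge P e A)) k)))⁻¹ x₁ x₂‖ ≤
          ((B1RG242Torus.α P a k * (P.L : ℝ) ^ (k * P.d)) / B1.aSeq a P.L k)⁻¹ *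
            (4 / (c240 P (min (a / (9 * (P.d + 1))) (1 / 12)) κ' * (1 - σ) -
              (4 / 3 * (P.d : ℝ) ^ 4 * (2 * creg * ec ^ β) ^ 2 +
                B1.aSeq a P.L k ^ 2 * (c₀ * Real.exp (1 / (8 * (L : ℝ) ^ s) / 2) * latticeConst P.d (1 / (8 * (L : ℝ) ^ s) / 2)) *
                  ((((⌊(((P.L : ℝ) ^ k) - 1 + R₀) / sg⌋₊ : ℝ) + 3) ^ (d + 1)) *
                      Real.exp (-(1 / (8 * (L : ℝ) ^ s) * (((P.L : ℝ) ^ k)⁻¹ * (2 * R)))) +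
                    Real.exp (-(1 / (8 * (L : ℝ) ^ s) / 2 * (((P.L : ℝ) ^ k)⁻¹ * R₁))))))) *
            Real.exp (-(ϑ * B5Ineq137Torus.T P (0 + k) x₁ x₂)) := by
  obtain ⟨s₀, H⟩ := decay241_regular_torus_cwt d L hL ha e creg β hcreg hβ
  refine ⟨s₀, fun s hs => ?_⟩
  obtain ⟨c₀, e₁, hc₀, he₁, M⟩ := H s hs
  refine ⟨c₀, e₁, hc₀, he₁, ?_⟩
  intro P hPd hPL k hk1 hkK hks hk' hsize A ec hec hece hreg c M0 hfit0 sg W hsg R R₀ R₁ hRm hR₁ hR10 hW hgap Λ hΛ T₁ δ' σ hInt hTree hσ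
    κ' hκ' hE ϑ hϑ0 hϑ hsmall h x₁ x₂
  have hk0 : 0 + k ≤ P.m + P.K := by omega
  have hj : 0 + k + 1 ≤ P.m + P.K := by omega
  have hak0 : 0 < B1.aSeq a P.L k := B1.aSeq_pos ha (B1RG242Torus.one_lt_cast_L P) hk1
  have hα : 0 < B1RG242Torus.α P a k := mul_pos hak0 (inv_pos.mpr (pow_pos (P.spacing_pos k) 2))
  have hA0 : 0 < B1RG242Torus.α P a k * (P.L : ℝ) ^ (k * P.d) := mul_pos hα (pow_pos P.cast_L_pos _)
  have hcube : ∀ α, IsBlockUnion k (cubeFamB hPd (P.L ^ k) c M0 sg W (L ^ k * L ^ s) α) := by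
    rw [← hPL]; exact isBlockUnion_cubeFamB hPd hk0 c M0 sg W
  have em : mulOpK h k = diagonal (fun y : Balaban1983to89.Site P (0 + k) => toC (h (cornerIter k y))) := rfl
  rw [lineIter_gaugeAct h (expGauge P e A) k hk0, op240_deltaLocT_gaugeAct hk0 hj (inv_ne_zero P.eps_pos.ne') hA0 _ h _ hcube, em,
    compress_sandwich, norm_inv_sandwich_apply _ (fun i => BIJ88Sect3Statements.norm_toC _)]
  exact M P hPd hPL k hk1 hkK hks hk' hsize A ec hec hece hreg c M0 hfit0 sg W hsg R R₀ R₁ hRm hR₁ hR10 hW hgap Λ hΛ T₁ δ' σ hInt hTree hσ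
    κ' hκ' hE ϑ hϑ0 hϑ hsmall x₁ x₂

end GaugeActLoc

end

end Literature.MathematicalPhysics.QuantumFieldTheory.BalabanImbrieJaffe1984to88.BIJ88Decay241SmallPlaquetteTorus
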